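import Literature.NumberTheory.PAdicHodge.AinfWeierstrassEtaPeriodTheta
import HarnessLib

/-!
# The η-Hasse criterion: `R_p ≡ c·X^p (mod p, X^{p+1})` with `p ∤ c` and `u^p ∉ (p, u^{p+1})` imply `R_p(u) ∉ p𝒪_{ℂ_F}`

Topic `Literature/NumberTheory/PAdicHodge`; THEOREMS ONLY. The transversality criterion of `AinfWeierstrassEtaPeriodTheta`
(`etaPeriod_not_mem_filOne : R_p(u₁) ∉ p𝒪_{ℂ_F} ⇒ ∫_t η ∉ Fil¹`) has the hypothesis `h₁ : R_p(u₁) ∉ p𝒪_{ℂ_F}` on the first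
point `u₁` of the `[p]`-compatible sequence. This file reduces `h₁` to two separate inputs:

* the **η-Hasse congruence** of the integral multiplication defect `R_p = Σ R_j X^j ∈ ℤ⟦X⟧` (`mulDefectInt W p`):
  `p ∣ R_j` for `j < p` and `p ∤ R_p` — a finite computation on the equation (for short Weierstrass models
  `R_p ≡ −2a₆·X⁵ (mod 5, X⁶)`, `R_p ≡ −3a₄²·X⁷ (mod 7, X⁸)`, units at supersingular reduction; Colmez 1992 §2, Katz 1981 §5);
* the **valuation condition** `u^p ∉ (p, u^{p+1})𝒪_{ℂ_F}` on the point (i.e. `p·v(u) < v(p)`: every `p`-torsion point outside the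
  canonical subgroup at supersingular reduction),

by the elementary decomposition `R_p(u) = Σ_{j<p} R_j u^j + R_p u^p + u^{p+1}·G(u)`, `G(u) ∈ 𝒪_{ℂ_F}`:

* `aeval_eq_sum_add_pow_mul` — `f(u) = Σ_{j≤n} f_j u^j + u^{n+1}·g(u)` for `f ∈ ℤ⟦X⟧`, `u ∈ 𝔪_{ℂ_F}`;
* **`mulDefectC_not_mem_span_of_etaHasse`** — the criterion; **`etaPeriod_not_mem_filOne_of_etaHasse`** — combined with
  `etaPeriod_not_mem_filOne`.

BSD context: crux K★ `stmt-BirchSwinnertonDyer-22226`, hDR sector (iii) road (A), input (Nη). BSD is not proved by any of this.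

## References
* P. Colmez, *Périodes p-adiques des variétés abéliennes*, Math. Ann. 292 (1992), §2. [Colmez1992PeriodesAbeliennes]
* N. M. Katz, *Crystalline cohomology, Dieudonné modules, and Jacobi sums* (1981), §5. [Katz1981CrystallineDieudonne]
-/

noncomputable section

open Ideal Filter Topology Field WittVector MvPowerSeries

namespace Literature.NumberTheory.PAdicHodge

open Literature.NumberTheory.GaloisRepresentations
open Literature.NumberTheory.GaloisRepresentations.IsNonarchimedeanLocalField
open Literature.NumberTheory.GaloisRepresentations.LubinTate

namespace AinfTop

variable {F : Type} [Field F] [ValuativeRel F] [TopologicalSpace F] [IsNonarchimedeanLocalField F] [CharZero F]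
  {p : ℕ} [Fact p.Prime] [Fact (¬ IsUnit (p : integerC F))]
  [IsAdicComplete (Ideal.span {(p : integerC F)}) (integerC F)]
  {hθ : Function.Surjective (fontaineTheta (integerC F) p)}
  (W : WeierstrassCurve ℤ)

omit [CharZero F] [Fact p.Prime] [Fact (¬ IsUnit (p : integerC F))] [IsAdicComplete (Ideal.span {(p : integerC F)}) (integerC F)] in
/-- **Truncated evaluation**: for `f ∈ ℤ⟦X⟧` and `u ∈ 𝔪_{ℂ_F}`, `f(u) = Σ_{j≤n} f_j u^j + u^{n+1}·g(u)` with `g(u) ∈ 𝒪_{ℂ_F}`.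
[cite: Colmez1992PeriodesAbeliennes, §2] -/
theorem aeval_eq_sum_add_pow_mul (f : PowerSeries ℤ) (n : ℕ) (u : (maxNilIdealC F).toIdeal) :
    ∃ G : CBall F, aeval ((maxNilIdealC F).hasEval fun _ : Unit => u) f =
      ∑ j ∈ Finset.range (n + 1), ((PowerSeries.coeff j f : ℤ) : CBall F) * (u : CBall F) ^ j + (u : CBall F) ^ (n + 1) * G := by
  set P : PowerSeries ℤ := ∑ j ∈ Finset.range (n + 1), PowerSeries.C (PowerSeries.coeff j f) * PowerSeries.X ^ j with hP
  have hdvd : (PowerSeries.X : PowerSeries ℤ) ^ (n + 1) ∣ f - P := by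
    rw [PowerSeries.X_pow_dvd_iff]
    intro m hm
    rw [map_sub, hP, map_sum]
    simp_rw [PowerSeries.coeff_C_mul_X_pow]
    rw [Finset.sum_ite_eq, if_pos (Finset.mem_range.2 hm), sub_self]
  obtain ⟨g, hg⟩ := hdvd
  have hx := (maxNilIdealC F).hasEval fun _ : Unit => u
  have hX : aeval hx (PowerSeries.X : PowerSeries ℤ) = (u : CBall F) := aeval_X' hx ()
  have hC : ∀ c : ℤ, aeval hx (PowerSeries.C c) = (c : CBall F) := fun c => by
    rw [PowerSeries.C_eq_algebraMap]
    exact ((aeval hx).commutes c).trans (map_intCast _ c)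
  refine ⟨aeval hx g, ?_⟩
  have hdec : f = P + PowerSeries.X ^ (n + 1) * g := by rw [← hg]; ring
  conv_lhs => rw [hdec]
  rw [map_add, map_mul, map_pow, hX, hP, map_sum]
  congr 1
  refine Finset.sum_congr rfl fun j _ => ?_
  rw [map_mul, map_pow, hX, hC]

omit [CharZero F] [Fact (¬ IsUnit (p : integerC F))] [IsAdicComplete (Ideal.span {(p : integerC F)}) (integerC F)] in
/-- **The η-Hasse criterion**: if `p ∣ R_j` (`j < p`), `p ∤ R_p` (the coefficient of `X^p` of `R_p = mulDefectInt W p`) and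
`u^p ∉ (p, u^{p+1})𝒪_{ℂ_F}`, then `R_p(u) ∉ p𝒪_{ℂ_F}`. [cite: Colmez1992PeriodesAbeliennes, §2] -/
theorem mulDefectC_not_mem_span_of_etaHasse
    (hlow : ∀ j, j < p → (p : ℤ) ∣ PowerSeries.coeff j (mulDefectInt W p))
    (htop : ¬ (p : ℤ) ∣ PowerSeries.coeff p (mulDefectInt W p)) (u : (maxNilIdealC F).toIdeal)
    (hu : (u : CBall F) ^ p ∉ Ideal.span {(p : CBall F), (u : CBall F) ^ (p + 1)}) :
    mulDefectC W p u ∉ Ideal.span {(p : CBall F)} := by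
  intro hmem
  apply hu
  obtain ⟨G, hG⟩ := aeval_eq_sum_add_pow_mul (F := F) (mulDefectInt W p) p u
  set J : Ideal (CBall F) := Ideal.span {(p : CBall F), (u : CBall F) ^ (p + 1)} with hJ
  have hpJ : (p : CBall F) ∈ J := Ideal.subset_span (by simp)
  have huJ : (u : CBall F) ^ (p + 1) ∈ J := Ideal.subset_span (by simp)
  have hRJ : (mulDefectC W p u : CBall F) ∈ J := by
    obtain ⟨c, hc⟩ := Ideal.mem_span_singleton'.1 hmem
    rw [← hc]
    exact J.mul_mem_left _ hpJ
  -- the low part is in `(p)`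
  have hlowJ : ∑ j ∈ Finset.range p, ((PowerSeries.coeff j (mulDefectInt W p) : ℤ) : CBall F) * (u : CBall F) ^ j ∈ J := by
    refine J.sum_mem fun j hj => ?_
    obtain ⟨m, hm⟩ := hlow j (Finset.mem_range.1 hj)
    rw [hm, Int.cast_mul, Int.cast_natCast, mul_assoc]
    exact J.mul_mem_right _ hpJ
  -- so `R_p · u^p ∈ J`
  have hval : (mulDefectC W p u : CBall F) =
      ∑ j ∈ Finset.range p, ((PowerSeries.coeff j (mulDefectInt W p) : ℤ) : CBall F) * (u : CBall F) ^ j +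
        ((PowerSeries.coeff p (mulDefectInt W p) : ℤ) : CBall F) * (u : CBall F) ^ p + (u : CBall F) ^ (p + 1) * G := by
    change aeval ((maxNilIdealC F).hasEval fun _ : Unit => u) (mulDefectInt W p) = _
    rw [hG, Finset.sum_range_succ]
  have htopJ : ((PowerSeries.coeff p (mulDefectInt W p) : ℤ) : CBall F) * (u : CBall F) ^ p ∈ J := by
    have h : ((PowerSeries.coeff p (mulDefectInt W p) : ℤ) : CBall F) * (u : CBall F) ^ p =
        (mulDefectC W p u : CBall F) - ∑ j ∈ Finset.range p, ((PowerSeries.coeff j (mulDefectInt W p) : ℤ) : CBall F) * (u : CBall F) ^ j -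
          (u : CBall F) ^ (p + 1) * G := by rw [hval]; ring
    rw [h]
    exact J.sub_mem (J.sub_mem hRJ hlowJ) (J.mul_mem_right _ huJ)
  -- Bezout: `a·R_p + b·p = 1`
  have hcop : IsCoprime (PowerSeries.coeff p (mulDefectInt W p)) (p : ℤ) :=
    ((Nat.prime_iff_prime_int.1 (Fact.out : p.Prime)).coprime_iff_not_dvd.2 htop).symm
  obtain ⟨a, b, hab⟩ := hcop
  have key : (u : CBall F) ^ p = (a : CBall F) * (((PowerSeries.coeff p (mulDefectInt W p) : ℤ) : CBall F) * (u : CBall F) ^ p) +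
      (b : CBall F) * (u : CBall F) ^ p * (p : CBall F) := by
    have h1 : ((a * PowerSeries.coeff p (mulDefectInt W p) + b * p : ℤ) : CBall F) = 1 := by rw [hab, Int.cast_one]
    rw [Int.cast_add, Int.cast_mul, Int.cast_mul, Int.cast_natCast] at h1
    linear_combination -((u : CBall F) ^ p) * h1
  rw [key]
  exact J.add_mem (J.mul_mem_left _ htopJ) (J.mul_mem_left _ hpJ)

/-- **η-Hasse ⇒ transversality**: under the η-Hasse congruence for `R_p` and the valuation condition on `u₁`, `∫_t η ∉ Fil¹ B_dR⁺`.
[cite: Colmez1992PeriodesAbeliennes, §2] -/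
theorem etaPeriod_not_mem_filOne_of_etaHasse
    (hlow : ∀ j, j < p → (p : ℤ) ∣ PowerSeries.coeff j (mulDefectInt W p))
    (htop : ¬ (p : ℤ) ∣ PowerSeries.coeff p (mulDefectInt W p)) {t : ℕ → (maxNilIdealC F).toIdeal} (ht0 : (t 0 : CBall F) = 0)
    (htp : ∀ n, mulPC F p W (t (n + 1)) = t n)
    (hu : ((t 1 : (maxNilIdealC F).toIdeal) : CBall F) ^ p ∉ Ideal.span {(p : CBall F), ((t 1 : (maxNilIdealC F).toIdeal) : CBall F) ^ (p + 1)}) :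
    etaPeriod W hθ t ht0 htp ∉ (BdRPlusTop.filOne F p).toIdeal :=
  etaPeriod_not_mem_filOne W ht0 htp (mulDefectC_not_mem_span_of_etaHasse W hlow htop (t 1) hu)


/-! ## §2 The point condition from norms -/

section Norm

omit [CharZero F] [Fact (¬ IsUnit (p : integerC F))] [IsAdicComplete (Ideal.span {(p : integerC F)}) (integerC F)] in
/-- **Valuation form of the point condition**: if `‖p‖ < ‖u‖^p` and `‖u‖ < 1` in `ℂ_F` then `u^p ∉ (p, u^{p+1})𝒪_{ℂ_F}`
(every element of the ideal has norm `≤ max(‖p‖, ‖u‖^{p+1}) < ‖u‖^p`, ultrametric inequality). [cite: Colmez1992PeriodesAbeliennes, §2] -/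
theorem pow_not_mem_span_of_norm_lt (u : CBall F) (hu1 : ‖(u : CompletedAlgClosure F)‖ < 1)
    (hpu : ‖(p : CompletedAlgClosure F)‖ < ‖(u : CompletedAlgClosure F)‖ ^ p) :
    u ^ p ∉ Ideal.span {(p : CBall F), u ^ (p + 1)} := by
  intro h
  rw [Ideal.mem_span_pair] at h
  obtain ⟨a, b, hab⟩ := h
  have hupos : 0 < ‖(u : CompletedAlgClosure F)‖ := by
    rcases (norm_nonneg (u : CompletedAlgClosure F)).eq_or_lt with h | h
    · exfalso
      rw [← h, zero_pow (Fact.out : p.Prime).ne_zero] at hpu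
      exact (not_lt.2 (norm_nonneg _)) hpu
    · exact h
  have ha : ‖((a : CBall F) : CompletedAlgClosure F)‖ ≤ 1 := (mem_unitBall_iff _).1 a.2
  have hb : ‖((b : CBall F) : CompletedAlgClosure F)‖ ≤ 1 := (mem_unitBall_iff _).1 b.2
  have h1 : ‖((a * (p : CBall F) : CBall F) : CompletedAlgClosure F)‖ < ‖(u : CompletedAlgClosure F)‖ ^ p := by
    rw [Subring.coe_mul, norm_mul]
    calc ‖((a : CBall F) : CompletedAlgClosure F)‖ * ‖(((p : CBall F)) : CompletedAlgClosure F)‖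
        ≤ 1 * ‖(((p : CBall F)) : CompletedAlgClosure F)‖ := by gcongr
      _ = ‖(p : CompletedAlgClosure F)‖ := by rw [one_mul]; rfl
      _ < _ := hpu
  have h2 : ‖((b * u ^ (p + 1) : CBall F) : CompletedAlgClosure F)‖ < ‖(u : CompletedAlgClosure F)‖ ^ p := by
    rw [Subring.coe_mul, norm_mul, SubmonoidClass.coe_pow, norm_pow]
    calc ‖((b : CBall F) : CompletedAlgClosure F)‖ * ‖(u : CompletedAlgClosure F)‖ ^ (p + 1)
        ≤ 1 * ‖(u : CompletedAlgClosure F)‖ ^ (p + 1) := by gcongr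
      _ = ‖(u : CompletedAlgClosure F)‖ ^ p * ‖(u : CompletedAlgClosure F)‖ := by rw [one_mul, pow_succ]
      _ < ‖(u : CompletedAlgClosure F)‖ ^ p * 1 := by gcongr
      _ = _ := mul_one _
  have h3 : ‖((u ^ p : CBall F) : CompletedAlgClosure F)‖ = ‖(u : CompletedAlgClosure F)‖ ^ p := by
    rw [SubmonoidClass.coe_pow, norm_pow]
  have h4 := IsUltrametricDist.norm_add_le_max (((a * (p : CBall F) : CBall F) : CompletedAlgClosure F))
    (((b * u ^ (p + 1) : CBall F) : CompletedAlgClosure F))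
  rw [← Subring.coe_add, hab, h3] at h4
  exact absurd h4 (not_le.2 (max_lt h1 h2))

/-- **η-Hasse ⇒ transversality, norm form**: `p ∣ R_j (j<p)`, `p ∤ R_p`, `‖u₁‖ < 1`, `‖p‖ < ‖u₁‖^p` ⇒ `∫_t η ∉ Fil¹ B_dR⁺`.
[cite: Colmez1992PeriodesAbeliennes, §2] -/
theorem etaPeriod_not_mem_filOne_of_etaHasse_of_norm
    (hlow : ∀ j, j < p → (p : ℤ) ∣ PowerSeries.coeff j (mulDefectInt W p))
    (htop : ¬ (p : ℤ) ∣ PowerSeries.coeff p (mulDefectInt W p)) {t : ℕ → (maxNilIdealC F).toIdeal} (ht0 : (t 0 : CBall F) = 0)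
    (htp : ∀ n, mulPC F p W (t (n + 1)) = t n)
    (hu1 : ‖(((t 1 : (maxNilIdealC F).toIdeal) : CBall F) : CompletedAlgClosure F)‖ < 1)
    (hpu : ‖(p : CompletedAlgClosure F)‖ < ‖(((t 1 : (maxNilIdealC F).toIdeal) : CBall F) : CompletedAlgClosure F)‖ ^ p) :
    etaPeriod W hθ t ht0 htp ∉ (BdRPlusTop.filOne F p).toIdeal :=
  etaPeriod_not_mem_filOne_of_etaHasse W hlow htop ht0 htp (pow_not_mem_span_of_norm_lt _ hu1 hpu)

end Norm

end AinfTop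

end Literature.NumberTheory.PAdicHodge

end
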